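import Summits.QuantumFields.BalabanUV.Beta.D1BFx.SliceTransferModel
import Literature.MathematicalPhysics.QuantumFieldTheory.Balaban1983to89.Beta.ConstraintElimination

/-!
# `BalabanUV.Beta.D1BFx.SliceTransferBordered` — road «BF-x» for binder row D1, leaf K-R1 AT MODEL LEVEL (part 3):
# ELIMINATING THE ORBIT PARAMETRISATION — twice the one-loop functional of a Faddeev–Popov matrix `F` with `FᵀF = ZᵀXZ`
# (`Z` a kernel basis of the scalar averaging `Q′`) is the functional of the `Q′`-BORDERED system `kkt X Q′` up to Gram terms of `Z` and
# `Q′` that CANCEL between the two ghosts of part 2; hence `2·secondVar G − 2·secondVar F = secondVar (kkt X_G Q′) − secondVar (kkt X_F Q′)`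

HONEST DEPENDENCY (page 1, mandatory): continuum YM on T⁴ ⇐ BetaPertH ∧ nine spine estimates (0/9 proved); BetaPertH ⇐ (D1) ∧
(D4) ∧ CAP+tail; G-an2-4 gates asym, D1 and NE2/3/4.  HONEST FRAMING (cell contract, verbatim): «discharging `BetaPertH` makes
Bałaban's UV stability UNCONDITIONAL — a real constructive-QFT result; it is NOT the continuum limit and NOT the Clay problem.»
THIS MODULE DISCHARGES NOTHING of the wall: [folklore] finite-dimensional algebra/calculus over the tree's `Beta.ConstraintElimination`
(general-basis elimination Jacobian `det_bordered_mul_det_basis_sq`) and parts 1–2 (`LogDetSecondVariation`, `SliceTransferModel`).  Owner's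
spec `HOME/b2b-balaban-beta-d1-p2/K-R1-SPEC.md` §3 (M3).  No `def`, no `Prop` mirror, no cited fact, 0 sorry; 0 wall binders; NOT D1, NOT
BetaPertH, NOT continuum, NOT Clay.

ABSOLUTE RULE (cell charter, verbatim): «No internally-minted statement may enter as a cited fact. Every hypothesis is either
kernel-proved in this package or a verbatim quotation of a PUBLISHED theorem with page reference. The manuscript(s) under audit are NOT
citable for their own disputed steps — they are the thing under adjudication; programme-internal (2001/route/tribunal) claims are never
citable.»

WHY.  Part 2 (`secondVar_sliceTransfer`) leaves the ghosts as `F = P W`, `G = τ W` for an arbitrary parametrisation `W` of the residual orbit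
directions.  On the road (K-R1-SPEC §2) `W = D_U ∘ Z` with `Z` a basis of the residual algebra `N(Q′(U)) = ker Q′(U)` (B9 (3.21), CONTEXT), so
`FᵀF = Zᵀ X_F Z`, `GᵀG = Zᵀ X_G Z` with the SCALAR forms `X_F = D*_U(D_U R_U D*_U)D_U` (`= Δ_U²` on `N(Q′)`) and `X_G = D*_U τᵀτ D_U`.  The
general-basis compression identity `det kkt X Q′ · det(ZᵀZ) = (−1)^{|blocks|}·det(ZᵀXZ)·det(Q′Q′ᵀ)` then trades each ghost for a `Q′`-BORDERED
scalar system plus Gram terms of `Z` and `Q′`, which are THE SAME for `F` and `G` and cancel: the kernel-level statement needs no basis.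

CONTENT (all [folklore]; scalars indexed by `σ ⊕ κ` with `κ` the block/constraint index, as in `ConstraintElimination`):
* §1 `det_fromCols_basis_sq` (`Q Z = 0 ⇒ det[Z | Qᵀ]² = det(ZᵀZ)·det(QQᵀ)`), `det_kkt_mul_det_gram` (the compression identity above, from the tree's
  `det_bordered_mul_det_basis_sq` with `Y := Qᵀ`), `absDet_kkt_mul`.
* §2 `two_secondVar_eq_bordered`: along `C²` curves with `FᵀF = ZᵀXZ`, `Q Z = 0` near `0` and `det F ≠ 0`, `det(QQᵀ) ≠ 0` at `0`:
  `2·secondVar F = secondVar (kkt X Q) + secondVar (ZᵀZ) − secondVar (QQᵀ)` (jets by the product rule).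
* §3 `secondVar_ghost_difference`: for two such `F`, `G` over the same `(Z, Q)`: `2·secondVar G − 2·secondVar F = secondVar (kkt X_G Q) − secondVar (kkt X_F Q)`.
* §4 **`secondVar_sliceTransfer_basisFree`** = part 2 + §3: `secondVar (kkt K [Q;τ]) = secondVar (kkt (K + PᵀP) Q) + secondVar (kkt X_G Q′) − secondVar (kkt X_F Q′)`
  — K-R1 AT MODEL LEVEL IN BASIS-FREE FORM (K-R1-SPEC §2's kernel-level target, in finite dimensions).
-/

noncomputable section

namespace Summit.QuantumFields.BalabanUV.Beta.D1BFx.SliceTransferBordered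

open Matrix Filter Finset
open scoped Topology
open Literature.MathematicalPhysics.QuantumFieldTheory.Balaban1983to89.Beta.Composition (kkt)
open Literature.MathematicalPhysics.QuantumFieldTheory.Balaban1983to89.Beta.ConstraintElimination (det_bordered_mul_det_basis_sq)
open Literature.Analysis.Calculus (eventually_det_ne_zero)
open Summit.QuantumFields.BalabanUV.Beta.D1BFx.LogDetSecondVariation (secondVar secondVar_comb_eq_zero)
open Summit.QuantumFields.BalabanUV.Beta.D1BFx.SliceTransferModel (hasDerivAt_matMul hasDerivAt_transpose hasDerivAt_transpose_mul
  hasDerivAt_kkt)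

/-! ## §1 The compression identity in general-basis form -/

section Algebra

variable {𝕜 : Type*} [Field 𝕜]
variable {σ κ : Type*} [Fintype σ] [Fintype κ] [DecidableEq σ] [DecidableEq κ]

/-- [folklore] For `Q Z = 0`: `[Z | Qᵀ]ᵀ[Z | Qᵀ] = [[ZᵀZ, 0],[0, QQᵀ]]`, hence `det[Z | Qᵀ]² = det(ZᵀZ)·det(QQᵀ)` (any basis `Z`, not only
orthonormal ones — cf. `GhostSchur.det_fromCols_kernelBasis_transpose_sq`). -/
theorem det_fromCols_basis_sq (Q : Matrix κ (σ ⊕ κ) 𝕜) (Z : Matrix (σ ⊕ κ) σ 𝕜) (hQZ : Q * Z = 0) :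
    (fromCols Z Qᵀ).det ^ 2 = (Zᵀ * Z).det * (Q * Qᵀ).det := by
  have hZQ : Zᵀ * Qᵀ = 0 := by rw [← transpose_mul, hQZ, transpose_zero]
  have h : (fromCols Z Qᵀ)ᵀ * fromCols Z Qᵀ = fromBlocks (Zᵀ * Z) (Zᵀ * Qᵀ) (Q * Z) (Q * Qᵀ) := by
    rw [transpose_fromCols, fromRows_mul_fromCols, transpose_transpose]
  rw [hZQ, hQZ] at h
  have hdet := congrArg det h
  rw [det_mul, det_transpose, det_fromBlocks_zero₂₁] at hdet
  rw [sq]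
  exact hdet

/-- [folklore] **THE COMPRESSION IDENTITY, general basis**: `Q Z = 0`, `det(QQᵀ) ≠ 0` ⟹
`det kkt X Q · det(ZᵀZ) = (−1)^{|κ|} · det(ZᵀXZ) · det(QQᵀ)` — the bordered determinant IS the determinant of the compression of `X` to
`ker Q` in the basis `Z`, up to the two Gram determinants (tree `det_bordered_mul_det_basis_sq` with the complement `Y := Qᵀ`). -/
theorem det_kkt_mul_det_gram (X : Matrix (σ ⊕ κ) (σ ⊕ κ) 𝕜) (Q : Matrix κ (σ ⊕ κ) 𝕜) (Z : Matrix (σ ⊕ κ) σ 𝕜)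
    (hQZ : Q * Z = 0) (hQ : (Q * Qᵀ).det ≠ 0) :
    (kkt X Q).det * (Zᵀ * Z).det = (-1) ^ Fintype.card κ * (Zᵀ * X * Z).det * (Q * Qᵀ).det := by
  have h := det_bordered_mul_det_basis_sq X Q Z Qᵀ hQZ (isUnit_iff_ne_zero.2 hQ)
  rw [det_fromCols_basis_sq Q Z hQZ] at h
  -- `kkt X Q = fromBlocks X Qᵀ Q 0` by definition
  have hk : (kkt X Q).det = (fromBlocks X Qᵀ Q 0).det := rfl
  rw [hk]
  -- cancel one factor `det(QQᵀ)`
  have h' : ((fromBlocks X Qᵀ Q 0).det * (Zᵀ * Z).det - (-1) ^ Fintype.card κ * (Zᵀ * X * Z).det * (Q * Qᵀ).det) * (Q * Qᵀ).det = 0 := by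
    have := h; ring_nf; ring_nf at this; linear_combination this
  rcases mul_eq_zero.1 h' with h1 | h1
  · exact sub_eq_zero.1 h1
  · exact absurd h1 hQ

end Algebra

/-! ## §2 Twice the ghost functional is the bordered functional plus cancelling Gram terms -/

section Curves

variable {σ κ : Type*} [Fintype σ] [Fintype κ] [DecidableEq σ] [DecidableEq κ]

/-- [folklore] Real absolute form of §1: `Q Z = 0`, `det(QQᵀ) ≠ 0`, `FᵀF = ZᵀXZ` ⟹ `|det kkt X Q| · |det(ZᵀZ)| = (det F)² · |det(QQᵀ)|`. -/
theorem absDet_kkt_mul (X : Matrix (σ ⊕ κ) (σ ⊕ κ) ℝ) (Q : Matrix κ (σ ⊕ κ) ℝ) (Z : Matrix (σ ⊕ κ) σ ℝ) (F : Matrix σ σ ℝ)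
    (hQZ : Q * Z = 0) (hQ : (Q * Qᵀ).det ≠ 0) (hF : Fᵀ * F = Zᵀ * X * Z) :
    |(kkt X Q).det| * |(Zᵀ * Z).det| = F.det ^ 2 * |(Q * Qᵀ).det| := by
  have h := det_kkt_mul_det_gram X Q Z hQZ hQ
  have hFF : (Zᵀ * X * Z).det = F.det ^ 2 := by rw [← hF, det_mul, det_transpose, sq]
  rw [hFF] at h
  have := congrArg abs h
  rw [abs_mul, abs_mul, abs_mul, abs_pow, abs_neg, abs_one, one_pow, one_mul, abs_pow, sq_abs] at this
  exact this

/-- [folklore] **TWICE THE GHOST FUNCTIONAL IS THE BORDERED FUNCTIONAL PLUS GRAM TERMS.**  Curves `F` (`σ × σ`), `X` (`(σ⊕κ)²`), `Z`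
(`(σ⊕κ) × σ`), `Q` (`κ × (σ⊕κ)`), `C²` at `0` (first derivatives near `0`, second derivatives at `0`), with `FᵀF = ZᵀXZ` and `Q Z = 0` near `0`,
`det F(0) ≠ 0`, `det(Q(0)Q(0)ᵀ) ≠ 0`.  Then, with all jets by the product rule,
`2·secondVar F = secondVar (kkt X Q) + secondVar (ZᵀZ) − secondVar (QQᵀ)` at `0`. -/
theorem two_secondVar_eq_bordered
    {F F₁ : ℝ → σ → σ → ℝ} {F₂ : Matrix σ σ ℝ} {X X₁ : ℝ → (σ ⊕ κ) → (σ ⊕ κ) → ℝ} {X₂ : Matrix (σ ⊕ κ) (σ ⊕ κ) ℝ}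
    {Z Z₁ : ℝ → (σ ⊕ κ) → σ → ℝ} {Z₂ : Matrix (σ ⊕ κ) σ ℝ} {Q Q₁ : ℝ → κ → (σ ⊕ κ) → ℝ} {Q₂ : Matrix κ (σ ⊕ κ) ℝ}
    (hF : ∀ᶠ u in 𝓝 (0 : ℝ), HasDerivAt F (F₁ u) u) (hF₁ : HasDerivAt F₁ (Matrix.of.symm F₂) 0)
    (hX : ∀ᶠ u in 𝓝 (0 : ℝ), HasDerivAt X (X₁ u) u) (hX₁ : HasDerivAt X₁ (Matrix.of.symm X₂) 0)
    (hZ : ∀ᶠ u in 𝓝 (0 : ℝ), HasDerivAt Z (Z₁ u) u) (hZ₁ : HasDerivAt Z₁ (Matrix.of.symm Z₂) 0)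
    (hQ : ∀ᶠ u in 𝓝 (0 : ℝ), HasDerivAt Q (Q₁ u) u) (hQ₁ : HasDerivAt Q₁ (Matrix.of.symm Q₂) 0)
    (hFF : ∀ᶠ u in 𝓝 (0 : ℝ), (Matrix.of (F u))ᵀ * Matrix.of (F u) = (Matrix.of (Z u))ᵀ * Matrix.of (X u) * Matrix.of (Z u))
    (hQZ : ∀ᶠ u in 𝓝 (0 : ℝ), Matrix.of (Q u) * Matrix.of (Z u) = 0)
    (hdF : (Matrix.of (F 0)).det ≠ 0) (hdQ : (Matrix.of (Q 0) * (Matrix.of (Q 0))ᵀ).det ≠ 0) :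
    2 * secondVar (Matrix.of (F 0)) (Matrix.of (F₁ 0)) F₂
      = secondVar (kkt (Matrix.of (X 0)) (Matrix.of (Q 0))) (kkt (Matrix.of (X₁ 0)) (Matrix.of (Q₁ 0))) (kkt X₂ Q₂)
        + secondVar ((Matrix.of (Z 0))ᵀ * Matrix.of (Z 0)) ((Matrix.of (Z₁ 0))ᵀ * Matrix.of (Z 0) + (Matrix.of (Z 0))ᵀ * Matrix.of (Z₁ 0))
            (Z₂ᵀ * Matrix.of (Z 0) + (Matrix.of (Z₁ 0))ᵀ * Matrix.of (Z₁ 0) + ((Matrix.of (Z₁ 0))ᵀ * Matrix.of (Z₁ 0) + (Matrix.of (Z 0))ᵀ * Z₂))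
        - secondVar (Matrix.of (Q 0) * (Matrix.of (Q 0))ᵀ) (Matrix.of (Q₁ 0) * (Matrix.of (Q 0))ᵀ + Matrix.of (Q 0) * (Matrix.of (Q₁ 0))ᵀ)
            (Q₂ * (Matrix.of (Q 0))ᵀ + Matrix.of (Q₁ 0) * (Matrix.of (Q₁ 0))ᵀ + (Matrix.of (Q₁ 0) * (Matrix.of (Q₁ 0))ᵀ + Matrix.of (Q 0) * Q₂ᵀ)) := by
  -- first jets read as matrices
  have hF' : ∀ᶠ u in 𝓝 (0 : ℝ), HasDerivAt F (Matrix.of.symm (Matrix.of (F₁ u))) u := hF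
  have hX' : ∀ᶠ u in 𝓝 (0 : ℝ), HasDerivAt X (Matrix.of.symm (Matrix.of (X₁ u))) u := hX
  have hZ' : ∀ᶠ u in 𝓝 (0 : ℝ), HasDerivAt Z (Matrix.of.symm (Matrix.of (Z₁ u))) u := hZ
  have hQ' : ∀ᶠ u in 𝓝 (0 : ℝ), HasDerivAt Q (Matrix.of.symm (Matrix.of (Q₁ u))) u := hQ
  -- (B) the bordered curve
  have hBd : ∀ᶠ u in 𝓝 (0 : ℝ), HasDerivAt (fun u => Matrix.of.symm (kkt (Matrix.of (X u)) (Matrix.of (Q u))))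
      ((fun u => Matrix.of.symm (kkt (Matrix.of (X₁ u)) (Matrix.of (Q₁ u)))) u) u := by
    filter_upwards [hX', hQ'] with u huX huQ
    exact hasDerivAt_kkt huX huQ
  have hB₁d : HasDerivAt (fun u => Matrix.of.symm (kkt (Matrix.of (X₁ u)) (Matrix.of (Q₁ u)))) (Matrix.of.symm (kkt X₂ Q₂)) 0 :=
    hasDerivAt_kkt hX₁ hQ₁
  -- (Zg) the Gram of the basis
  have hZgd : ∀ᶠ u in 𝓝 (0 : ℝ), HasDerivAt (fun u => Matrix.of.symm ((Matrix.of (Z u))ᵀ * Matrix.of (Z u)))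
      ((fun u => Matrix.of.symm ((Matrix.of (Z₁ u))ᵀ * Matrix.of (Z u) + (Matrix.of (Z u))ᵀ * Matrix.of (Z₁ u))) u) u := by
    filter_upwards [hZ'] with u huZ
    exact hasDerivAt_transpose_mul huZ huZ
  have hZg₁d : HasDerivAt (fun u => Matrix.of.symm ((Matrix.of (Z₁ u))ᵀ * Matrix.of (Z u) + (Matrix.of (Z u))ᵀ * Matrix.of (Z₁ u)))
      (Matrix.of.symm (Z₂ᵀ * Matrix.of (Z 0) + (Matrix.of (Z₁ 0))ᵀ * Matrix.of (Z₁ 0)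
        + ((Matrix.of (Z₁ 0))ᵀ * Matrix.of (Z₁ 0) + (Matrix.of (Z 0))ᵀ * Z₂))) 0 := by
    have h := (hasDerivAt_transpose_mul hZ₁ hZ'.self_of_nhds).add (hasDerivAt_transpose_mul hZ'.self_of_nhds hZ₁)
    exact h
  -- (Qg) the Gram of the constraints
  have hQt : ∀ᶠ u in 𝓝 (0 : ℝ), HasDerivAt (fun u => Matrix.of.symm (Matrix.of (Q u))ᵀ) (Matrix.of.symm (Matrix.of (Q₁ u))ᵀ) u := by
    filter_upwards [hQ'] with u huQ
    exact hasDerivAt_transpose huQ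
  have hQgd : ∀ᶠ u in 𝓝 (0 : ℝ), HasDerivAt (fun u => Matrix.of.symm (Matrix.of (Q u) * (Matrix.of (Q u))ᵀ))
      ((fun u => Matrix.of.symm (Matrix.of (Q₁ u) * (Matrix.of (Q u))ᵀ + Matrix.of (Q u) * (Matrix.of (Q₁ u))ᵀ)) u) u := by
    filter_upwards [hQ', hQt] with u huQ huQt
    have h := hasDerivAt_matMul (Y := fun u => Matrix.of.symm (Matrix.of (Q u))ᵀ) huQ huQt
    exact h
  have hQg₁d : HasDerivAt (fun u => Matrix.of.symm (Matrix.of (Q₁ u) * (Matrix.of (Q u))ᵀ + Matrix.of (Q u) * (Matrix.of (Q₁ u))ᵀ))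
      (Matrix.of.symm (Q₂ * (Matrix.of (Q 0))ᵀ + Matrix.of (Q₁ 0) * (Matrix.of (Q₁ 0))ᵀ
        + (Matrix.of (Q₁ 0) * (Matrix.of (Q₁ 0))ᵀ + Matrix.of (Q 0) * Q₂ᵀ))) 0 := by
    have h1 := hasDerivAt_matMul (Y := fun u => Matrix.of.symm (Matrix.of (Q u))ᵀ) hQ₁ (hasDerivAt_transpose hQ'.self_of_nhds)
    have h2 := hasDerivAt_matMul (Y := fun u => Matrix.of.symm (Matrix.of (Q₁ u))ᵀ) hQ'.self_of_nhds (hasDerivAt_transpose hQ₁)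
    have h := h1.add h2
    exact h
  -- nondegeneracy near 0 and the logarithmic identity
  have hFne : ∀ᶠ u in 𝓝 (0 : ℝ), (Matrix.of (F u)).det ≠ 0 := eventually_det_ne_zero hF.self_of_nhds.hasFDerivAt hdF
  have hQne : ∀ᶠ u in 𝓝 (0 : ℝ), (Matrix.of (Matrix.of.symm (Matrix.of (Q u) * (Matrix.of (Q u))ᵀ))).det ≠ 0 :=
    eventually_det_ne_zero hQgd.self_of_nhds.hasFDerivAt hdQ
  have hlog : ∀ᶠ u in 𝓝 (0 : ℝ),
      2 * Real.log |(Matrix.of (F u)).det|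
      + (-1) * Real.log |(Matrix.of (Matrix.of.symm (kkt (Matrix.of (X u)) (Matrix.of (Q u))))).det|
      + (-1) * Real.log |(Matrix.of (Matrix.of.symm ((Matrix.of (Z u))ᵀ * Matrix.of (Z u)))).det|
      + 1 * Real.log |(Matrix.of (Matrix.of.symm (Matrix.of (Q u) * (Matrix.of (Q u))ᵀ))).det| = 0 := by
    filter_upwards [hFF, hQZ, hFne, hQne] with u huFF huQZ huF huQ
    have huQ' : (Matrix.of (Q u) * (Matrix.of (Q u))ᵀ).det ≠ 0 := huQ
    have hid := absDet_kkt_mul (Matrix.of (X u)) (Matrix.of (Q u)) (Matrix.of (Z u)) (Matrix.of (F u)) huQZ huQ' huFF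
    have hFpos : 0 < |(Matrix.of (F u)).det| := abs_pos.2 huF
    have hQpos : 0 < |(Matrix.of (Q u) * (Matrix.of (Q u))ᵀ).det| := abs_pos.2 huQ'
    have hR : 0 < (Matrix.of (F u)).det ^ 2 * |(Matrix.of (Q u) * (Matrix.of (Q u))ᵀ).det| := mul_pos (by positivity) hQpos
    have hKpos : 0 < |(kkt (Matrix.of (X u)) (Matrix.of (Q u))).det| := by
      refine abs_pos.2 fun h0 => ?_
      rw [h0, abs_zero, zero_mul] at hid
      linarith
    have hZpos : 0 < |((Matrix.of (Z u))ᵀ * Matrix.of (Z u)).det| := by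
      refine abs_pos.2 fun h0 => ?_
      rw [h0, abs_zero, mul_zero] at hid
      linarith
    have hl := congrArg Real.log hid
    rw [Real.log_mul hKpos.ne' hZpos.ne', Real.log_mul (pow_ne_zero 2 huF) hQpos.ne', ← Real.log_abs ((Matrix.of (F u)).det ^ 2), abs_pow,
      Real.log_pow] at hl
    show 2 * Real.log |(Matrix.of (F u)).det| + (-1) * Real.log |(kkt (Matrix.of (X u)) (Matrix.of (Q u))).det|
      + (-1) * Real.log |((Matrix.of (Z u))ᵀ * Matrix.of (Z u)).det| + 1 * Real.log |(Matrix.of (Q u) * (Matrix.of (Q u))ᵀ).det| = 0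
    push_cast at hl
    linarith
  -- nondegeneracy at 0 of the bordered and basis Gram determinants
  have hid0 := absDet_kkt_mul (Matrix.of (X 0)) (Matrix.of (Q 0)) (Matrix.of (Z 0)) (Matrix.of (F 0)) hQZ.self_of_nhds hdQ hFF.self_of_nhds
  have hR0 : 0 < (Matrix.of (F 0)).det ^ 2 * |(Matrix.of (Q 0) * (Matrix.of (Q 0))ᵀ).det| := mul_pos (by positivity) (abs_pos.2 hdQ)
  have hdB : (Matrix.of (Matrix.of.symm (kkt (Matrix.of (X 0)) (Matrix.of (Q 0))))).det ≠ 0 := by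
    intro h0
    have h0' : (kkt (Matrix.of (X 0)) (Matrix.of (Q 0))).det = 0 := h0
    rw [h0', abs_zero, zero_mul] at hid0
    linarith
  have hdZ : (Matrix.of (Matrix.of.symm ((Matrix.of (Z 0))ᵀ * Matrix.of (Z 0)))).det ≠ 0 := by
    intro h0
    have h0' : ((Matrix.of (Z 0))ᵀ * Matrix.of (Z 0)).det = 0 := h0
    rw [h0', abs_zero, mul_zero] at hid0
    linarith
  -- differentiate twice (part 1)
  have h := secondVar_comb_eq_zero (a := 2) (b := -1) (c := -1) (d := 1) (k := 0)
    hF hF₁ hdF hBd hB₁d hdB hZgd hZg₁d hdZ hQgd hQg₁d hdQ hlog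
  have h' : 2 * secondVar (Matrix.of (F 0)) (Matrix.of (F₁ 0)) F₂
      + (-1) * secondVar (kkt (Matrix.of (X 0)) (Matrix.of (Q 0))) (kkt (Matrix.of (X₁ 0)) (Matrix.of (Q₁ 0))) (kkt X₂ Q₂)
      + (-1) * secondVar ((Matrix.of (Z 0))ᵀ * Matrix.of (Z 0)) ((Matrix.of (Z₁ 0))ᵀ * Matrix.of (Z 0) + (Matrix.of (Z 0))ᵀ * Matrix.of (Z₁ 0))
            (Z₂ᵀ * Matrix.of (Z 0) + (Matrix.of (Z₁ 0))ᵀ * Matrix.of (Z₁ 0) + ((Matrix.of (Z₁ 0))ᵀ * Matrix.of (Z₁ 0) + (Matrix.of (Z 0))ᵀ * Z₂))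
      + 1 * secondVar (Matrix.of (Q 0) * (Matrix.of (Q 0))ᵀ) (Matrix.of (Q₁ 0) * (Matrix.of (Q 0))ᵀ + Matrix.of (Q 0) * (Matrix.of (Q₁ 0))ᵀ)
            (Q₂ * (Matrix.of (Q 0))ᵀ + Matrix.of (Q₁ 0) * (Matrix.of (Q₁ 0))ᵀ + (Matrix.of (Q₁ 0) * (Matrix.of (Q₁ 0))ᵀ + Matrix.of (Q 0) * Q₂ᵀ)) = 0 := h
  linarith

/-- [folklore] **THE TWO GHOSTS OF THE SLICE TRANSFER IN BORDERED FORM** (K-R1-SPEC §3 (M3)): two Faddeev–Popov-type curves `F`, `G` over the SAME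
basis and constraint curves `(Z, Q)`, with `FᵀF = Zᵀ X_F Z`, `GᵀG = Zᵀ X_G Z`: at `0`,
`2·secondVar G − 2·secondVar F = secondVar (kkt X_G Q) − secondVar (kkt X_F Q)` — the Gram terms of `Z` and `Q` cancel; no basis survives. -/
theorem secondVar_ghost_difference
    {F F₁ G G₁ : ℝ → σ → σ → ℝ} {F₂ G₂ : Matrix σ σ ℝ}
    {XF XF₁ XG XG₁ : ℝ → (σ ⊕ κ) → (σ ⊕ κ) → ℝ} {XF₂ XG₂ : Matrix (σ ⊕ κ) (σ ⊕ κ) ℝ}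
    {Z Z₁ : ℝ → (σ ⊕ κ) → σ → ℝ} {Z₂ : Matrix (σ ⊕ κ) σ ℝ} {Q Q₁ : ℝ → κ → (σ ⊕ κ) → ℝ} {Q₂ : Matrix κ (σ ⊕ κ) ℝ}
    (hF : ∀ᶠ u in 𝓝 (0 : ℝ), HasDerivAt F (F₁ u) u) (hF₁ : HasDerivAt F₁ (Matrix.of.symm F₂) 0)
    (hG : ∀ᶠ u in 𝓝 (0 : ℝ), HasDerivAt G (G₁ u) u) (hG₁ : HasDerivAt G₁ (Matrix.of.symm G₂) 0)
    (hXF : ∀ᶠ u in 𝓝 (0 : ℝ), HasDerivAt XF (XF₁ u) u) (hXF₁ : HasDerivAt XF₁ (Matrix.of.symm XF₂) 0)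
    (hXG : ∀ᶠ u in 𝓝 (0 : ℝ), HasDerivAt XG (XG₁ u) u) (hXG₁ : HasDerivAt XG₁ (Matrix.of.symm XG₂) 0)
    (hZ : ∀ᶠ u in 𝓝 (0 : ℝ), HasDerivAt Z (Z₁ u) u) (hZ₁ : HasDerivAt Z₁ (Matrix.of.symm Z₂) 0)
    (hQ : ∀ᶠ u in 𝓝 (0 : ℝ), HasDerivAt Q (Q₁ u) u) (hQ₁ : HasDerivAt Q₁ (Matrix.of.symm Q₂) 0)
    (hFF : ∀ᶠ u in 𝓝 (0 : ℝ), (Matrix.of (F u))ᵀ * Matrix.of (F u) = (Matrix.of (Z u))ᵀ * Matrix.of (XF u) * Matrix.of (Z u))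
    (hGG : ∀ᶠ u in 𝓝 (0 : ℝ), (Matrix.of (G u))ᵀ * Matrix.of (G u) = (Matrix.of (Z u))ᵀ * Matrix.of (XG u) * Matrix.of (Z u))
    (hQZ : ∀ᶠ u in 𝓝 (0 : ℝ), Matrix.of (Q u) * Matrix.of (Z u) = 0)
    (hdF : (Matrix.of (F 0)).det ≠ 0) (hdG : (Matrix.of (G 0)).det ≠ 0) (hdQ : (Matrix.of (Q 0) * (Matrix.of (Q 0))ᵀ).det ≠ 0) :
    2 * secondVar (Matrix.of (G 0)) (Matrix.of (G₁ 0)) G₂ - 2 * secondVar (Matrix.of (F 0)) (Matrix.of (F₁ 0)) F₂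
      = secondVar (kkt (Matrix.of (XG 0)) (Matrix.of (Q 0))) (kkt (Matrix.of (XG₁ 0)) (Matrix.of (Q₁ 0))) (kkt XG₂ Q₂)
        - secondVar (kkt (Matrix.of (XF 0)) (Matrix.of (Q 0))) (kkt (Matrix.of (XF₁ 0)) (Matrix.of (Q₁ 0))) (kkt XF₂ Q₂) := by
  have h1 := two_secondVar_eq_bordered hF hF₁ hXF hXF₁ hZ hZ₁ hQ hQ₁ hFF hQZ hdF hdQ
  have h2 := two_secondVar_eq_bordered hG hG₁ hXG hXG₁ hZ hZ₁ hQ hQ₁ hGG hQZ hdG hdQ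
  linarith

end Curves

/-! ## §4 K-R1 at model level, basis-free form: parts 2 + 3 -/

section Final

variable {ν μ σ κ : Type*} [Fintype ν] [Fintype μ] [Fintype σ] [Fintype κ] [DecidableEq ν] [DecidableEq μ] [DecidableEq σ] [DecidableEq κ]

open Summit.QuantumFields.BalabanUV.Beta.D1BFx.SliceTransferModel (secondVar_sliceTransfer hasDerivAt_const_mul)

/-- [folklore] **K-R1 AT MODEL LEVEL, BASIS-FREE** (K-R1-SPEC §2, kernel-level target in finite dimensions): the data of part 2
(`secondVar_sliceTransfer`: `K, Q, P, W, τ`) together with a scalar averaging `Q′`, a kernel basis `Z` (`Q′Z = 0`) and scalar forms `XF`, `XG` with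
`(PW)ᵀ(PW) = Zᵀ·XF·Z` and `(τW)ᵀ(τW) = Zᵀ·XG·Z` near `0` (on the road: `W = D_U Z`, `XF = D*_U(D_U R_U D*_U)D_U`, `XG = D*_U τᵀτ D_U`) give, at `0`,
`secondVar (kkt K [Q;τ]) = secondVar (kkt (K + PᵀP) Q) + secondVar (kkt XG Q′) − secondVar (kkt XF Q′)` — the axial bordered functional equals
the weighted bordered functional PLUS the axial-ghost bordered functional MINUS the Faddeev–Popov-ghost bordered functional; no orbit basis is left. -/
theorem secondVar_sliceTransfer_basisFree
    {K K₁ : ℝ → ν → ν → ℝ} {K₂ : Matrix ν ν ℝ} {Q Q₁ : ℝ → μ → ν → ℝ} {Q₂ : Matrix μ ν ℝ}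
    {P P₁ : ℝ → σ → ν → ℝ} {P₂ : Matrix σ ν ℝ} {W W₁ : ℝ → ν → σ → ℝ} {W₂ : Matrix ν σ ℝ} (τ : Matrix σ ν ℝ)
    {XF XF₁ XG XG₁ : ℝ → (σ ⊕ κ) → (σ ⊕ κ) → ℝ} {XF₂ XG₂ : Matrix (σ ⊕ κ) (σ ⊕ κ) ℝ}
    {Z Z₁ : ℝ → (σ ⊕ κ) → σ → ℝ} {Z₂ : Matrix (σ ⊕ κ) σ ℝ} {Q' Q'₁ : ℝ → κ → (σ ⊕ κ) → ℝ} {Q'₂ : Matrix κ (σ ⊕ κ) ℝ}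
    (hK : ∀ᶠ u in 𝓝 (0 : ℝ), HasDerivAt K (K₁ u) u) (hK₁ : HasDerivAt K₁ (Matrix.of.symm K₂) 0)
    (hQ : ∀ᶠ u in 𝓝 (0 : ℝ), HasDerivAt Q (Q₁ u) u) (hQ₁ : HasDerivAt Q₁ (Matrix.of.symm Q₂) 0)
    (hP : ∀ᶠ u in 𝓝 (0 : ℝ), HasDerivAt P (P₁ u) u) (hP₁ : HasDerivAt P₁ (Matrix.of.symm P₂) 0)
    (hW : ∀ᶠ u in 𝓝 (0 : ℝ), HasDerivAt W (W₁ u) u) (hW₁ : HasDerivAt W₁ (Matrix.of.symm W₂) 0)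
    (hXF : ∀ᶠ u in 𝓝 (0 : ℝ), HasDerivAt XF (XF₁ u) u) (hXF₁ : HasDerivAt XF₁ (Matrix.of.symm XF₂) 0)
    (hXG : ∀ᶠ u in 𝓝 (0 : ℝ), HasDerivAt XG (XG₁ u) u) (hXG₁ : HasDerivAt XG₁ (Matrix.of.symm XG₂) 0)
    (hZ : ∀ᶠ u in 𝓝 (0 : ℝ), HasDerivAt Z (Z₁ u) u) (hZ₁ : HasDerivAt Z₁ (Matrix.of.symm Z₂) 0)
    (hQ' : ∀ᶠ u in 𝓝 (0 : ℝ), HasDerivAt Q' (Q'₁ u) u) (hQ'₁ : HasDerivAt Q'₁ (Matrix.of.symm Q'₂) 0)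
    (hKW : ∀ᶠ u in 𝓝 (0 : ℝ), Matrix.of (K u) * Matrix.of (W u) = 0)
    (hKtW : ∀ᶠ u in 𝓝 (0 : ℝ), (Matrix.of (K u))ᵀ * Matrix.of (W u) = 0)
    (hQW : ∀ᶠ u in 𝓝 (0 : ℝ), Matrix.of (Q u) * Matrix.of (W u) = 0)
    (hQ'Z : ∀ᶠ u in 𝓝 (0 : ℝ), Matrix.of (Q' u) * Matrix.of (Z u) = 0)
    (hFF : ∀ᶠ u in 𝓝 (0 : ℝ), (Matrix.of (P u) * Matrix.of (W u))ᵀ * (Matrix.of (P u) * Matrix.of (W u))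
      = (Matrix.of (Z u))ᵀ * Matrix.of (XF u) * Matrix.of (Z u))
    (hGG : ∀ᶠ u in 𝓝 (0 : ℝ), (τ * Matrix.of (W u))ᵀ * (τ * Matrix.of (W u)) = (Matrix.of (Z u))ᵀ * Matrix.of (XG u) * Matrix.of (Z u))
    (hτW : (τ * Matrix.of (W 0)).det ≠ 0) (hPW : (Matrix.of (P 0) * Matrix.of (W 0)).det ≠ 0)
    (hM : (kkt (Matrix.of (K 0)) (fromRows (Matrix.of (Q 0)) τ)).det ≠ 0) (hdQ' : (Matrix.of (Q' 0) * (Matrix.of (Q' 0))ᵀ).det ≠ 0) :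
    secondVar (kkt (Matrix.of (K 0)) (fromRows (Matrix.of (Q 0)) τ))
        (kkt (Matrix.of (K₁ 0)) (fromRows (Matrix.of (Q₁ 0)) (0 : Matrix σ ν ℝ))) (kkt K₂ (fromRows Q₂ (0 : Matrix σ ν ℝ)))
    = secondVar (kkt (Matrix.of (K 0) + (Matrix.of (P 0))ᵀ * Matrix.of (P 0)) (Matrix.of (Q 0)))
        (kkt (Matrix.of (K₁ 0) + ((Matrix.of (P₁ 0))ᵀ * Matrix.of (P 0) + (Matrix.of (P 0))ᵀ * Matrix.of (P₁ 0))) (Matrix.of (Q₁ 0)))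
        (kkt (K₂ + (P₂ᵀ * Matrix.of (P 0) + (Matrix.of (P₁ 0))ᵀ * Matrix.of (P₁ 0)
          + ((Matrix.of (P₁ 0))ᵀ * Matrix.of (P₁ 0) + (Matrix.of (P 0))ᵀ * P₂))) Q₂)
      + secondVar (kkt (Matrix.of (XG 0)) (Matrix.of (Q' 0))) (kkt (Matrix.of (XG₁ 0)) (Matrix.of (Q'₁ 0))) (kkt XG₂ Q'₂)
      - secondVar (kkt (Matrix.of (XF 0)) (Matrix.of (Q' 0))) (kkt (Matrix.of (XF₁ 0)) (Matrix.of (Q'₁ 0))) (kkt XF₂ Q'₂) := by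
  -- part 2
  have h2 := secondVar_sliceTransfer τ hK hK₁ hQ hQ₁ hP hP₁ hW hW₁ hKW hKtW hQW hτW hPW hM
  -- the two ghost curves `F = P W`, `G = τ W` and their jets
  have hP' : ∀ᶠ u in 𝓝 (0 : ℝ), HasDerivAt P (Matrix.of.symm (Matrix.of (P₁ u))) u := hP
  have hW' : ∀ᶠ u in 𝓝 (0 : ℝ), HasDerivAt W (Matrix.of.symm (Matrix.of (W₁ u))) u := hW
  have hFd : ∀ᶠ u in 𝓝 (0 : ℝ), HasDerivAt (fun u => Matrix.of.symm (Matrix.of (P u) * Matrix.of (W u)))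
      ((fun u => Matrix.of.symm (Matrix.of (P₁ u) * Matrix.of (W u) + Matrix.of (P u) * Matrix.of (W₁ u))) u) u := by
    filter_upwards [hP', hW'] with u huP huW
    exact hasDerivAt_matMul huP huW
  have hF₁d : HasDerivAt (fun u => Matrix.of.symm (Matrix.of (P₁ u) * Matrix.of (W u) + Matrix.of (P u) * Matrix.of (W₁ u)))
      (Matrix.of.symm (P₂ * Matrix.of (W 0) + Matrix.of (P₁ 0) * Matrix.of (W₁ 0)
        + (Matrix.of (P₁ 0) * Matrix.of (W₁ 0) + Matrix.of (P 0) * W₂))) 0 := by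
    have h := (hasDerivAt_matMul hP₁ hW'.self_of_nhds).add (hasDerivAt_matMul hP'.self_of_nhds hW₁)
    exact h
  have hGd : ∀ᶠ u in 𝓝 (0 : ℝ), HasDerivAt (fun u => Matrix.of.symm (τ * Matrix.of (W u)))
      ((fun u => Matrix.of.symm (τ * Matrix.of (W₁ u))) u) u := by
    filter_upwards [hW'] with u huW
    exact hasDerivAt_const_mul τ huW
  have hG₁d : HasDerivAt (fun u => Matrix.of.symm (τ * Matrix.of (W₁ u))) (Matrix.of.symm (τ * W₂)) 0 :=
    hasDerivAt_const_mul τ hW₁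
  -- part 3
  have h3 := secondVar_ghost_difference (F := fun u => Matrix.of.symm (Matrix.of (P u) * Matrix.of (W u)))
    (G := fun u => Matrix.of.symm (τ * Matrix.of (W u))) hFd hF₁d hGd hG₁d hXF hXF₁ hXG hXG₁ hZ hZ₁ hQ' hQ'₁ hFF hGG hQ'Z hPW hτW hdQ'
  have h3' : 2 * secondVar (τ * Matrix.of (W 0)) (τ * Matrix.of (W₁ 0)) (τ * W₂)
      - 2 * secondVar (Matrix.of (P 0) * Matrix.of (W 0))
        (Matrix.of (P₁ 0) * Matrix.of (W 0) + Matrix.of (P 0) * Matrix.of (W₁ 0))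
        (P₂ * Matrix.of (W 0) + Matrix.of (P₁ 0) * Matrix.of (W₁ 0) + (Matrix.of (P₁ 0) * Matrix.of (W₁ 0) + Matrix.of (P 0) * W₂))
      = secondVar (kkt (Matrix.of (XG 0)) (Matrix.of (Q' 0))) (kkt (Matrix.of (XG₁ 0)) (Matrix.of (Q'₁ 0))) (kkt XG₂ Q'₂)
        - secondVar (kkt (Matrix.of (XF 0)) (Matrix.of (Q' 0))) (kkt (Matrix.of (XF₁ 0)) (Matrix.of (Q'₁ 0))) (kkt XF₂ Q'₂) := h3
  linarith

end Final

end Summit.QuantumFields.BalabanUV.Beta.D1BFx.SliceTransferBordered
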